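import Summits.ValiantsHypothesis.ValiantsHypothesis.Theorems.LacunarySymmetroidMatrixDescartesPivotTwoDirectionsAnySize
import Summits.ValiantsHypothesis.ValiantsHypothesis.Theorems.LacunarySymmetroidMatrixDescartesPivotTwoDirectionsBlockLawAll

/-!
# `MatrixDescartes` census — two-direction pencils at every size: `Z₊ ≤ 2·K_u·K_v`, the doubly-straddling `−2`, and the
# BLOCK `(2,2)` LAW (`Z₊ ≤ 6 = 2K − 2`) AT EVERY SIZE `m`

HONEST FRAMING.  Object-search cell `pub-symmetroid`, seat `val-sym-mdr-p2` (generation 25); helper file `--supports` the crux item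
stmt-ValiantsHypothesis-18050 (`Theses.LacunarySymmetroid.MatrixDescartes`, OPEN, on HOLD) with NO closure claim.  Third sheet of the size-free
two-direction series (`…AnySize`: `det (X^e J + f·uuᵀ + g·vvᵀ) = X^{(m−2)e}·Φ`; `…AnySizeGram`: the Gram dichotomy).  In the size-`m + 2` weak hard
cell (`det J < 0`, `mu = det J·(uᵀJ⁻¹u) ≤ 0`, `mv = det J·(vᵀJ⁻¹v) ≤ 0`, `D2 = det J·((uᵀJ⁻¹u)(vᵀJ⁻¹v) − (uᵀJ⁻¹v)(vᵀJ⁻¹u)) > 0`) the remaining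
`(2,K)` two-direction laws of the tree hold VERBATIM at every size, by the scalar theorems they were proved from:
* **`posRoots_twoDir_anySize_le_two_mul_sides`**: `Z₊ ≤ 2·#supp f·#supp g` (the tree's `TwoDirections.posRoots_le_two_mul_sides`, val-sym-mdr-p1
  g12, at `m = 2`; here from `PosEnds.posRoots_add_ends_le_two_mul_card_sumset` and the sumset bound);
* **`posRoots_twoDir_anySize_add_two_le_of_both_straddle`**: both directions straddle the pivot ⇒ `Z₊ + 2 ≤ 2·#supp f·#supp g`
  (`PosEnds.posRoots_add_two_le_of_both_straddle`);
* **`blockLaw_anySize_posRoots_le_six`**: the SIGN-SEPARATED `(2,2)` BLOCK (`f = c₁X^{p₁} + c₂X^{p₂}`, `p₂ < p₁ < e`; `g = c₃X^{q₁} + c₄X^{q₂}`,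
  `e < q₁ < q₂`; `cᵢ > 0`; `mu, mv < 0`, `D2 > 0`) has **`Z₊ ≤ 6`** at every size — the BLOCK `(2,2)` LAW of `…BlockLaw` / `…BlockLawII` /
  `…BlockLawAll` (val-sym-mdr-p1 g12–g13: kill-five in the interleaving chambers, window counts elsewhere) transported by the identity
  `Φ = nine-nomial` (`Φ_block22_eq_nineNomial`, a `ring` identity).
Nothing here bears on `Theses.LacunarySymmetroid.MatrixDescartes` in its window, on `KPlusLogSqLaw`, on `DoorA26` / `DoorA34`, on the cell's
registers or credences, or on `VP ≠ VNP`.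

[folklore] Bookkeeping over `…AnySize.posRoots_twoDir_anySize_eq`, `…PosEnds`, `…BlockLawAll.blockLaw_nineNomial_le_six`.  No definitions,
no named facts.
-/

-- `Summit.ValiantsHypothesis.ValiantsHypothesis.…` repeats a component by the D-0017 layout
-- (single-conjunct summit), which the `dupNamespace` linter flags; the name is mandated.
set_option linter.dupNamespace false

namespace Summit.ValiantsHypothesis.ValiantsHypothesis.Theorems.LacunarySymmetroidMatrixDescartes.Pivot.TwoDirections.AnySize

open Polynomial Matrix Finset
open scoped BigOperators

variable {m : ℕ}

/-- **`Z₊ ≤ 2·K_u·K_v` AT EVERY SIZE** (size-`m + 2` weak hard cell; `f, g ≠ 0` of non-negative coefficients). [this file] -/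
theorem posRoots_twoDir_anySize_le_two_mul_sides (e : ℕ) (J : Matrix (Fin (m + 2)) (Fin (m + 2)) ℝ) (hJ : J.det < 0)
    (u v : Fin (m + 2) → ℝ) (f g : ℝ[X]) (hf : f ≠ 0) (hg : g ≠ 0) (hf0 : ∀ i, 0 ≤ f.coeff i) (hg0 : ∀ j, 0 ≤ g.coeff j)
    (hmu : J.det * (u ⬝ᵥ J⁻¹ *ᵥ u) ≤ 0) (hmv : J.det * (v ⬝ᵥ J⁻¹ *ᵥ v) ≤ 0)
    (hD2 : 0 < J.det * ((u ⬝ᵥ J⁻¹ *ᵥ u) * (v ⬝ᵥ J⁻¹ *ᵥ v) - (u ⬝ᵥ J⁻¹ *ᵥ v) * (v ⬝ᵥ J⁻¹ *ᵥ u))) :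
    ((Matrix.det (((X : ℝ[X]) ^ e) • J.map Polynomial.C + f • (vecMulVec u u).map Polynomial.C
        + g • (vecMulVec v v).map Polynomial.C)).roots.toFinset.filter (fun t => 0 < t)).card
      ≤ 2 * (f.support.card * g.support.card) := by
  have h := posRoots_twoDir_anySize_add_ends_le e J hJ u v f g hf hg hf0 hg0 hmu hmv hD2
  have hc := PosEnds.card_sumset_le f g
  omega

/-- **BOTH DIRECTIONS STRADDLE THE PIVOT ⇒ `Z₊ + 2 ≤ 2·K_u·K_v`, AT EVERY SIZE.** [this file] -/
theorem posRoots_twoDir_anySize_add_two_le_of_both_straddle (e : ℕ) (J : Matrix (Fin (m + 2)) (Fin (m + 2)) ℝ) (hJ : J.det < 0)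
    (u v : Fin (m + 2) → ℝ) (f g : ℝ[X]) (hf : f ≠ 0) (hg : g ≠ 0) (hf0 : ∀ i, 0 ≤ f.coeff i) (hg0 : ∀ j, 0 ≤ g.coeff j)
    (hmu : J.det * (u ⬝ᵥ J⁻¹ *ᵥ u) ≤ 0) (hmv : J.det * (v ⬝ᵥ J⁻¹ *ᵥ v) ≤ 0)
    (hD2 : 0 < J.det * ((u ⬝ᵥ J⁻¹ *ᵥ u) * (v ⬝ᵥ J⁻¹ *ᵥ v) - (u ⬝ᵥ J⁻¹ *ᵥ v) * (v ⬝ᵥ J⁻¹ *ᵥ u)))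
    (hfs : f.natTrailingDegree < e ∧ e < f.natDegree) (hgs : g.natTrailingDegree < e ∧ e < g.natDegree) :
    ((Matrix.det (((X : ℝ[X]) ^ e) • J.map Polynomial.C + f • (vecMulVec u u).map Polynomial.C
        + g • (vecMulVec v v).map Polynomial.C)).roots.toFinset.filter (fun t => 0 < t)).card + 2
      ≤ 2 * (f.support.card * g.support.card) := by
  rw [posRoots_twoDir_anySize_eq e J hJ.ne u v f g]
  exact PosEnds.posRoots_add_two_le_of_both_straddle e f g _ _ _ _ hf hg hf0 hg0 hJ.le hmu hmv hD2 hfs hgs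

/-- The scalar `Φ` of a `(2,2)` block is the nine-nomial of `…BlockLawAll` (any parameters). [bookkeeping] -/
theorem Φ_block22_eq_nineNomial (e p₁ p₂ q₁ q₂ : ℕ) (dJ mu mv D2 c₁ c₂ c₃ c₄ : ℝ) :
    (X : ℝ[X]) ^ (2 * e) * Polynomial.C dJ + (X : ℝ[X]) ^ e * (Polynomial.C c₁ * X ^ p₁ + Polynomial.C c₂ * X ^ p₂) * Polynomial.C mu
        + (X : ℝ[X]) ^ e * (Polynomial.C c₃ * X ^ q₁ + Polynomial.C c₄ * X ^ q₂) * Polynomial.C mv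
        + (Polynomial.C c₁ * X ^ p₁ + Polynomial.C c₂ * X ^ p₂) * (Polynomial.C c₃ * X ^ q₁ + Polynomial.C c₄ * X ^ q₂) * Polynomial.C D2
      = ∑ i : Fin 9, Polynomial.C ((![dJ, c₁ * mu, c₂ * mu, c₃ * mv, c₄ * mv, c₁ * c₃ * D2, c₂ * c₃ * D2, c₁ * c₄ * D2, c₂ * c₄ * D2]
            : Fin 9 → ℝ) i)
          * X ^ ((![2 * e, e + p₁, e + p₂, e + q₁, e + q₂, p₁ + q₁, p₂ + q₁, p₁ + q₂, p₂ + q₂] : Fin 9 → ℕ) i) := by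
  simp only [Fin.sum_univ_succ, Fin.sum_univ_zero, Matrix.cons_val_zero, Matrix.cons_val_succ, map_mul, pow_add]
  simp
  ring

/-- **THE BLOCK `(2,2)` LAW AT EVERY SIZE: `Z₊ ≤ 6`.**  `F = X^e J + (c₁X^{p₁} + c₂X^{p₂})·uuᵀ + (c₃X^{q₁} + c₄X^{q₂})·vvᵀ` of size `m + 2`
with `p₂ < p₁ < e < q₁ < q₂`, `cᵢ > 0`, `det J < 0`, `mu, mv < 0`, `D2 > 0` (size-`m + 2` hard cell) has at most SIX distinct positive
determinant roots (`BlockLawAll.blockLaw_nineNomial_le_six`). [this file] -/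
theorem blockLaw_anySize_posRoots_le_six (e p₁ p₂ q₁ q₂ : ℕ) (h21 : p₂ < p₁) (h1e : p₁ < e) (he1 : e < q₁) (h12 : q₁ < q₂)
    (J : Matrix (Fin (m + 2)) (Fin (m + 2)) ℝ) (hJ : J.det < 0) (u v : Fin (m + 2) → ℝ) (c₁ c₂ c₃ c₄ : ℝ)
    (hc₁ : 0 < c₁) (hc₂ : 0 < c₂) (hc₃ : 0 < c₃) (hc₄ : 0 < c₄)
    (hmu : J.det * (u ⬝ᵥ J⁻¹ *ᵥ u) < 0) (hmv : J.det * (v ⬝ᵥ J⁻¹ *ᵥ v) < 0)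
    (hD2 : 0 < J.det * ((u ⬝ᵥ J⁻¹ *ᵥ u) * (v ⬝ᵥ J⁻¹ *ᵥ v) - (u ⬝ᵥ J⁻¹ *ᵥ v) * (v ⬝ᵥ J⁻¹ *ᵥ u))) :
    ((Matrix.det (((X : ℝ[X]) ^ e) • J.map Polynomial.C
        + (Polynomial.C c₁ * X ^ p₁ + Polynomial.C c₂ * X ^ p₂) • (vecMulVec u u).map Polynomial.C
        + (Polynomial.C c₃ * X ^ q₁ + Polynomial.C c₄ * X ^ q₂) • (vecMulVec v v).map Polynomial.C)).roots.toFinset.filter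
        (fun t => 0 < t)).card ≤ 6 := by
  rw [posRoots_twoDir_anySize_eq e J hJ.ne u v _ _, Φ_block22_eq_nineNomial]
  exact BlockLawAll.blockLaw_nineNomial_le_six e p₁ p₂ q₁ q₂ h21 h1e he1 h12 _ _ _ _ c₁ c₂ c₃ c₄ hc₁ hc₂ hc₃ hc₄ hmu hmv hD2

end Summit.ValiantsHypothesis.ValiantsHypothesis.Theorems.LacunarySymmetroidMatrixDescartes.Pivot.TwoDirections.AnySize
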